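import Literature.NumberTheory.EllipticCurves.BSDSelmerCMPConverseCMFieldTwistFamilyPrintedProofs
import Literature.NumberTheory.EllipticCurves.BSDSelmer
import Mathlib.NumberTheory.Padics.HeightOneSpectrum
import Mathlib.Data.Nat.Squarefree
import Mathlib.Algebra.Squarefree.Basic
import HarnessLib

/-!
# Square classes of `ℚ` = squarefree integers, `H(d) = |d|`: the BKLOS height ordering over `ℚ` is
# the usual ordering of quadratic twists (Bhargava–Klagsbrun–Lemke Oliver–Shnidman 2019, §2)

M. Bhargava, Z. Klagsbrun, R. J. Lemke Oliver, A. Shnidman, *`3`-isogeny Selmer groups and ranks of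
abelian varieties in quadratic twist families over a number field*, Duke Math. J. **168** (2019),
§2 (arXiv:1709.09790, held text chunk p0004 L20–L30), after defining the height
`H(s) := ∏_{𝔭 : v_𝔭(s) odd} N(𝔭)` of `s ∈ F^*/F^{*2}` and `Σ(X) := {s ∈ Σ : H(s) < X}`:

> "If `F = ℚ`, then `Σ(X)` consists of the squareclasses of all squarefree integers of absolute
> value less than `X`, recovering the usual ordering of quadratic twists over `ℚ`."

The tree carries TWO density currencies for quadratic twist families over `ℚ`:
`Literature.NumberTheory.EllipticCurves.twistDensity P δ` (`BSDSelmer.lean`, bsd.S34 — Smith's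
normalisation: natural density `δ` of `{d squarefree : P d}` by `|d| ≤ X`, a `Tendsto`) and
`SquareClassProportionGe P δ` (`BSDSelmerCMPConverseCMFieldTwistFamily.lean` — the BKLOS reading
"for at least `δ` of `t ∈ K^×/(K^×)²`", `liminf ≥ δ` of `#{t : H(t) < X, P t}/#{t : H(t) < X}`, any
number field `K`; used over `K = ℚ` by `GoldfeldProportionsCremona19a3.lean`). This file PROVES the
printed sentence and hence the dictionary between the two currencies over `ℚ`:

* `squareClassOf x` (**definition**, any field): the square class of `x ∈ K` in `K^×/(K^×)²`
  (junk value `1` at `x = 0`); `squareClassOf_of_ne_zero`, `squareClassOf_mul_sq`.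
* `exists_squarefree_squareClassOf_eq`, `eq_of_squareClassOf_intCast_eq` — **`ℚ^×/(ℚ^×)²` is in
  bijection with the squarefree integers** `d` via `d ↦ [d]`.
* (private: the prime `v` of `𝓞_ℚ` is `(p)`, `p = natGenerator v` — Mathlib
  `Rat.HeightOneSpectrum.primesEquiv` — of norm `p`);
  `valuationOfNeZeroMod_two_squareClassOf_ne_one_iff` — for squarefree `d`, `v_p(d)` is odd iff
  `p ∣ d`.
* `squareClassHeight_squareClassOf_intCast` — **`H([d]) = |d|` for squarefree `d`** (the printed
  sentence).
* `natCard_squareClass_height_lt_eq` — `#{t ∈ ℚ^×/(ℚ^×)² : H(t) < X, P t} =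
  #{d ∈ ℤ squarefree : |d| < X, P [d]}`.
* `squareClassProportionGe_rat_iff` — over `ℚ`, "at least `δ` of `t`" (BKLOS) `⟺`
  `δ ≤ liminf_X #{d squarefree : |d| < X, P [d]} / #{d squarefree : |d| < X}`;
  `squareClassProportionGe_iff_of_twistDensity` — if `{d : P [d]}` has natural density `δ₀`
  (`twistDensity`), then "at least `δ` of `t`" `⟺ δ ≤ δ₀`.
* `twistClassSatisfies_squareClassOf_iff` (any field; `_selmerCorank_…`, `_analyticRank_…` over a
  number field) — "`P(E^{([s])})`" is `P(E^{(s)})` for isomorphism-invariant `P`;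
  `squareClassProportionGe_twist_rat_iff`, `squareClassProportionGe_twist_iff_of_twistDensity`,
  `squareClassProportionGe_twist_selmerCorank_rat_iff`, `…_analyticRank_rat_iff` — the twist-family
  form over `ℚ`: "at least `δ` of the `E^{(t)}` satisfy `P`" `⟺`
  `δ ≤ liminf_X #{d squarefree : |d| < X, P(E^{(d)})} / #{d squarefree : |d| < X}`.

## References

* [BhargavaKlagsbrunLemkeOliverShnidman2019] Duke Math. J. 168 (2019), no. 15, 2951–2989 =
  arXiv:1709.09790: §2 (definition of `H(s)`, `Σ(X)`, and the sentence on `F = ℚ`), chunk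
  p0004 L20–L30.
* [arXiv250317619] A. Smith, *The Birch and Swinnerton-Dyer conjecture implies Goldfeld's
  conjecture*, arXiv:2503.17619, §1 (densities over squarefree `d`, `|d| ≤ H`; the tree's
  `twistDensity`).
-/

noncomputable section

open scoped Classical
open Filter Topology IsDedekindDomain NumberField

universe u

namespace Literature.NumberTheory.EllipticCurves

/-! ## The square class of an element -/

section AnyField

variable {K : Type u} [Field K]

/-- **The square class `[x] ∈ K^×/(K^×)²` of `x ∈ K`** (BKLOS 2019, §2: "squareclass
`s ∈ F^*/F^{*2}`"; the class of the unit `x` when `x ≠ 0`, junk value `1` at `x = 0`).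
[cite: BhargavaKlagsbrunLemkeOliverShnidman2019, §2 (squareclasses s ∈ F*/F*²)] -/
def squareClassOf (x : K) : SquareClass K :=
  if h : x = 0 then 1 else QuotientGroup.mk (Units.mk0 x h)

/-- Unfolding `squareClassOf` at a nonzero element. [cite: BhargavaKlagsbrunLemkeOliverShnidman2019, §2 (squareclasses s ∈ F*/F*²)] -/
theorem squareClassOf_of_ne_zero {x : K} (h : x ≠ 0) :
    squareClassOf x = QuotientGroup.mk (Units.mk0 x h) := by
  unfold squareClassOf
  rw [dif_neg h]

/-- The square class of a unit is its class. [cite: BhargavaKlagsbrunLemkeOliverShnidman2019, §2 (squareclasses s ∈ F*/F*²)] -/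
theorem squareClassOf_units (s : Kˣ) : squareClassOf (s : K) = QuotientGroup.mk s := by
  rw [squareClassOf_of_ne_zero s.ne_zero]
  congr 1
  exact Units.mk0_val s s.ne_zero

/-- `squareClassOf` is surjective onto `K^×/(K^×)²` (every class is the class of a unit).
[cite: BhargavaKlagsbrunLemkeOliverShnidman2019, §2 (squareclasses s ∈ F*/F*²)] -/
theorem squareClassOf_surjective : Function.Surjective (squareClassOf (K := K)) := by
  intro t
  obtain ⟨s, rfl⟩ := QuotientGroup.mk_surjective t
  exact ⟨s, squareClassOf_units s⟩

/-- `[x u²] = [x]` for `x, u ≠ 0`. [cite: BhargavaKlagsbrunLemkeOliverShnidman2019, §2 (squareclasses s ∈ F*/F*²)] -/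
theorem squareClassOf_mul_sq {x u : K} (hx : x ≠ 0) (hu : u ≠ 0) :
    squareClassOf (x * u ^ 2) = squareClassOf x := by
  rw [squareClassOf_of_ne_zero hx, squareClassOf_of_ne_zero (mul_ne_zero hx (pow_ne_zero 2 hu)),
    QuotientGroup.eq]
  refine ⟨(Units.mk0 u hu)⁻¹, ?_⟩
  ext
  simp [mul_comm]

/-- `[x] = [y]` for `x, y ≠ 0` iff `y = x u²` for some `u ≠ 0`.
[cite: BhargavaKlagsbrunLemkeOliverShnidman2019, §2 (squareclasses s ∈ F*/F*²)] -/
theorem squareClassOf_eq_iff {x y : K} (hx : x ≠ 0) (hy : y ≠ 0) :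
    squareClassOf x = squareClassOf y ↔ ∃ u : K, u ≠ 0 ∧ y = x * u ^ 2 := by
  constructor
  · intro h
    rw [squareClassOf_of_ne_zero hx, squareClassOf_of_ne_zero hy] at h
    obtain ⟨u, hu⟩ := exists_eq_mul_sq_of_mk_eq h
    refine ⟨u, u.ne_zero, ?_⟩
    have := congrArg Units.val hu
    simpa using this
  · rintro ⟨u, hu, rfl⟩
    exact (squareClassOf_mul_sq hx hu).symm

end AnyField

/-! ## Over `ℚ`: square classes are squarefree integers -/

section Rat

/-- **Every square class of `ℚ` is the class of a squarefree integer** (BKLOS 2019, §2: over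
`F = ℚ` the squareclasses are "the squareclasses of all squarefree integers"): for `q = n/m` in
lowest terms, `[q] = [nm] = [± a]` where `|nm| = b² a` with `a` squarefree
(`Nat.sq_mul_squarefree_of_pos`). [cite: BhargavaKlagsbrunLemkeOliverShnidman2019, §2 (Σ(X) for F = ℚ)] -/
theorem exists_squarefree_squareClassOf_eq (t : SquareClass ℚ) :
    ∃ d : ℤ, Squarefree d ∧ squareClassOf (d : ℚ) = t := by
  obtain ⟨q, rfl⟩ := squareClassOf_surjective t
  by_cases hq : q = 0
  · refine ⟨1, squarefree_one, ?_⟩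
    subst hq
    rw [Int.cast_one, squareClassOf_of_ne_zero one_ne_zero]
    unfold squareClassOf
    rw [dif_pos rfl, QuotientGroup.eq_one_iff]
    exact ⟨1, by ext; simp⟩
  -- `q = n / m`, `N = n m ≠ 0`, `|N| = b² a`
  set n : ℤ := q.num with hn
  set m : ℕ := q.den with hm
  have hn0 : n ≠ 0 := Rat.num_ne_zero.2 hq
  have hm0 : (m : ℤ) ≠ 0 := by exact_mod_cast q.den_nz
  have hNpos : 0 < (n * m).natAbs := Int.natAbs_pos.2 (mul_ne_zero hn0 hm0)
  obtain ⟨a, b, ha, hb, hab, hsq⟩ := Nat.sq_mul_squarefree_of_pos hNpos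
  refine ⟨n.sign * a, ?_, ?_⟩
  · rw [← Int.squarefree_natAbs, Int.natAbs_mul, Int.natAbs_sign_of_ne_zero hn0, one_mul,
      Int.natAbs_natCast]
    exact hsq
  · -- `q = (sign n · a) · (b / m)²`
    have hqeq : (q : ℚ) = ((n.sign * a : ℤ) : ℚ) * ((b : ℚ) / m) ^ 2 := by
      have hm0' : (m : ℚ) ≠ 0 := by exact_mod_cast q.den_nz
      have hNZ : (n * m : ℤ) = n.sign * ((b : ℤ) ^ 2 * a) := by
        have h1 : ((n * m).natAbs : ℤ) = (b : ℤ) ^ 2 * a := by exact_mod_cast hab.symm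
        calc (n * m : ℤ) = (n * m).sign * ((n * m).natAbs : ℤ) := (Int.sign_mul_natAbs _).symm
          _ = n.sign * (m : ℤ).sign * ((b : ℤ) ^ 2 * a) := by rw [Int.sign_mul, h1]
          _ = n.sign * ((b : ℤ) ^ 2 * a) := by
            rw [Int.sign_natCast_of_ne_zero q.den_nz, mul_one]
      have hcast : (n : ℚ) * m = (n.sign : ℤ) * ((b : ℚ) ^ 2 * a) := by exact_mod_cast hNZ
      have hq' : q = (n : ℚ) / m := (Rat.num_div_den q).symm
      rw [hq', div_pow, mul_div_assoc', div_eq_div_iff hm0' (pow_ne_zero 2 hm0')]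
      push_cast
      linear_combination (m : ℚ) * hcast
    have hd0 : ((n.sign * a : ℤ) : ℚ) ≠ 0 := by
      have : (n.sign * a : ℤ) ≠ 0 :=
        mul_ne_zero (fun h0 ↦ hn0 (Int.sign_eq_zero_iff_zero.1 h0)) (by exact_mod_cast ha.ne')
      exact_mod_cast this
    have hu0 : ((b : ℚ) / m) ≠ 0 :=
      div_ne_zero (by exact_mod_cast hb.ne') (by exact_mod_cast q.den_nz)
    rw [hqeq, squareClassOf_mul_sq hd0 hu0]

/-- **Distinct squarefree integers have distinct square classes in `ℚ`**: if `[d] = [d']` then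
`d' = d u²` with `u = r/s` in lowest terms, so `d' s² = d r²`, whence `r² ∣ d'` and `s² ∣ d`; as
`d, d'` are squarefree, `r = ±1`, `s = 1` and `d = d'`.
[cite: BhargavaKlagsbrunLemkeOliverShnidman2019, §2 (Σ(X) for F = ℚ)] -/
theorem eq_of_squareClassOf_intCast_eq {d d' : ℤ} (hd : Squarefree d) (hd' : Squarefree d')
    (h : squareClassOf (d : ℚ) = squareClassOf (d' : ℚ)) : d = d' := by
  have hd0 : d ≠ 0 := hd.ne_zero
  have hd0' : d' ≠ 0 := hd'.ne_zero
  obtain ⟨u, hu, hdu⟩ :=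
    (squareClassOf_eq_iff (by exact_mod_cast hd0) (by exact_mod_cast hd0')).1 h
  -- `u = r / s` in lowest terms; `d' s² = d r²` in `ℤ`
  set r : ℤ := u.num with hr
  set s : ℕ := u.den with hs
  have hs0 : (s : ℚ) ≠ 0 := by exact_mod_cast u.den_nz
  have hueq : u = (r : ℚ) / s := (Rat.num_div_den u).symm
  have key : d' * (s : ℤ) ^ 2 = d * r ^ 2 := by
    have h1 : (d' : ℚ) * (s : ℚ) ^ 2 = d * (r : ℚ) ^ 2 := by
      rw [hdu, hueq, div_pow]
      field_simp
    exact_mod_cast h1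
  have hcop : IsCoprime r (s : ℤ) := Rat.isCoprime_num_den u
  -- `r² ∣ d'`
  have hr2 : r * r ∣ d' := by
    have h1 : r ^ 2 ∣ d' * (s : ℤ) ^ 2 := ⟨d, by rw [key]; ring⟩
    have h2 : r ^ 2 ∣ d' := (hcop.pow (m := 2) (n := 2)).dvd_of_dvd_mul_right h1
    rwa [sq] at h2
  -- `s² ∣ d`
  have hs2 : (s : ℤ) * s ∣ d := by
    have h1 : (s : ℤ) ^ 2 ∣ d * r ^ 2 := ⟨d', by rw [← key]; ring⟩
    have h2 : (s : ℤ) ^ 2 ∣ d := (hcop.symm.pow (m := 2) (n := 2)).dvd_of_dvd_mul_right h1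
    rwa [sq] at h2
  have hru : IsUnit r := hd' r hr2
  have hsu : IsUnit (s : ℤ) := hd (s : ℤ) hs2
  have hr1 : r ^ 2 = 1 := by
    rcases Int.isUnit_iff.1 hru with h1 | h1 <;> rw [h1] <;> norm_num
  have hs1 : (s : ℤ) ^ 2 = 1 := by
    rcases Int.isUnit_iff.1 hsu with h1 | h1
    · rw [h1]; norm_num
    · exfalso
      have : (0 : ℤ) ≤ (s : ℤ) := Int.natCast_nonneg s
      omega
  rw [hr1, hs1, mul_one, mul_one] at key
  exact key.symm

/-- Squarefree integers have nonzero image in `ℚ`. [folklore] -/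
private theorem cast_ne_zero_of_squarefree {d : ℤ} (hd : Squarefree d) : (d : ℚ) ≠ 0 := by
  exact_mod_cast hd.ne_zero

/-! ### The primes of `𝓞_ℚ`: `v = (p)`, `N(v) = p`, and the parity of `v_p` on squarefree `d` -/

/-- **The prime `v` of `𝓞_ℚ` is `(p)` with `p = natGenerator v`** (Mathlib
`Rat.HeightOneSpectrum.span_natGenerator`, transported back along `𝓞_ℚ ≃ ℤ`). [folklore] -/
private theorem rat_asIdeal_eq_span_natGenerator (v : HeightOneSpectrum (𝓞 ℚ)) :
    v.asIdeal = Ideal.span {((Rat.HeightOneSpectrum.natGenerator v : ℕ) : 𝓞 ℚ)} := by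
  set e := Rat.IsIntegralClosure.intEquiv (𝓞 ℚ) with he
  calc v.asIdeal = Ideal.comap e (Ideal.map e v.asIdeal) :=
        (Ideal.comap_map_of_bijective e e.bijective).symm
    _ = Ideal.comap e (Ideal.span {((Rat.HeightOneSpectrum.natGenerator v : ℕ) : ℤ)}) := by
        rw [Rat.HeightOneSpectrum.span_natGenerator]
    _ = Ideal.map e.symm (Ideal.span {((Rat.HeightOneSpectrum.natGenerator v : ℕ) : ℤ)}) :=
        (Ideal.map_symm e).symm
    _ = Ideal.span {((Rat.HeightOneSpectrum.natGenerator v : ℕ) : 𝓞 ℚ)} := by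
        rw [Ideal.map_span, Set.image_singleton, map_natCast]

/-- `p = natGenerator v` is a prime element of `𝓞_ℚ`. [folklore] -/
private theorem rat_prime_natGenerator_cast (v : HeightOneSpectrum (𝓞 ℚ)) :
    Prime ((Rat.HeightOneSpectrum.natGenerator v : ℕ) : 𝓞 ℚ) := by
  set e := Rat.IsIntegralClosure.intEquiv (𝓞 ℚ) with he
  have hp : Prime ((Rat.HeightOneSpectrum.natGenerator v : ℕ) : ℤ) :=
    Nat.prime_iff_prime_int.1 (Rat.HeightOneSpectrum.prime_natGenerator v)
  have h1 : e.symm ((Rat.HeightOneSpectrum.natGenerator v : ℕ) : ℤ) =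
      ((Rat.HeightOneSpectrum.natGenerator v : ℕ) : 𝓞 ℚ) := map_natCast e.symm _
  rw [← h1]
  exact (MulEquiv.prime_iff e.symm).2 hp

/-- **`N(v) = p`** for the prime `v = (p)` of `𝓞_ℚ` (cf. the tree's
`UniformABCConjecture.absNorm_asIdeal_eq_natGenerator`, same statement; private copy to keep this
file's imports inside the elliptic-curve area). [folklore] -/
private theorem rat_absNorm_asIdeal_eq_natGenerator (v : HeightOneSpectrum (𝓞 ℚ)) :
    Ideal.absNorm v.asIdeal = Rat.HeightOneSpectrum.natGenerator v := by
  rw [rat_asIdeal_eq_span_natGenerator, Ideal.absNorm_span_singleton]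
  have h : ((Rat.HeightOneSpectrum.natGenerator v : ℕ) : 𝓞 ℚ) =
      algebraMap ℤ (𝓞 ℚ) (Rat.HeightOneSpectrum.natGenerator v : ℤ) := by simp
  rw [h, Algebra.norm_algebraMap, NumberField.RingOfIntegers.rank, Module.finrank_self, pow_one,
    Int.natAbs_natCast]

/-- Divisibility of integers read in `𝓞_ℚ`: `(p : 𝓞_ℚ) ∣ (a : 𝓞_ℚ) → (p : ℤ) ∣ a`. [folklore] -/
private theorem rat_natCast_dvd_of_cast_dvd_cast {p : ℕ} {a : ℤ} (h : ((p : ℕ) : 𝓞 ℚ) ∣ (a : 𝓞 ℚ)) :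
    (p : ℤ) ∣ a := by
  set e := Rat.IsIntegralClosure.intEquiv (𝓞 ℚ) with he
  have h1 := map_dvd e h
  rwa [map_natCast, map_intCast] at h1

/-- **For squarefree `d`, the valuation of `[d]` at `v = (p)` is odd iff `p ∣ d`** (the exponent of
`p` in `d` is `1` if `p ∣ d` and `0` otherwise). BKLOS 2019, §2 (`H(s)` over `F = ℚ`).
[cite: BhargavaKlagsbrunLemkeOliverShnidman2019, §2 (Σ(X) for F = ℚ)] -/
theorem valuationOfNeZeroMod_two_squareClassOf_ne_one_iff (v : HeightOneSpectrum (𝓞 ℚ)) {d : ℤ}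
    (hd : Squarefree d) :
    v.valuationOfNeZeroMod 2 (squareClassOf (d : ℚ)) ≠ 1 ↔
      ((Rat.HeightOneSpectrum.natGenerator v : ℕ) : ℤ) ∣ d := by
  have hpp : (Rat.HeightOneSpectrum.natGenerator v).Prime := Rat.HeightOneSpectrum.prime_natGenerator v
  have hprime := rat_prime_natGenerator_cast v
  have hd0 : (d : ℚ) ≠ 0 := cast_ne_zero_of_squarefree hd
  have hdO : (d : 𝓞 ℚ) ≠ 0 := by exact_mod_cast hd.ne_zero
  rw [squareClassOf_of_ne_zero hd0, Ne, HeightOneSpectrum.valuationOfNeZeroMod_mk_eq_one_iff,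
    HeightOneSpectrum.toAdd_valuationOfNeZero_of_eq_algebraMap v (r := (d : 𝓞 ℚ)) hdO
      (by rw [Units.val_mk0, map_intCast]),
    rat_asIdeal_eq_span_natGenerator]
  by_cases hpd : ((Rat.HeightOneSpectrum.natGenerator v : ℕ) : ℤ) ∣ d
  · obtain ⟨a, ha⟩ := hpd
    -- `p ∤ a` since `d = p a` is squarefree
    have hpa : ¬ ((Rat.HeightOneSpectrum.natGenerator v : ℕ) : 𝓞 ℚ) ∣ (a : 𝓞 ℚ) := by
      intro h
      obtain ⟨c, hc⟩ := rat_natCast_dvd_of_cast_dvd_cast h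
      have hu : IsUnit ((Rat.HeightOneSpectrum.natGenerator v : ℕ) : ℤ) :=
        hd _ ⟨c, by rw [ha, hc]; ring⟩
      rcases Int.isUnit_iff.1 hu with h1 | h1
      · exact hpp.ne_one (by exact_mod_cast h1)
      · have := hpp.pos
        omega
    have hcount : (Associates.mk (Ideal.span {((Rat.HeightOneSpectrum.natGenerator v : ℕ) : 𝓞 ℚ)})).count
        (Associates.mk (Ideal.span {(d : 𝓞 ℚ)})).factors = 1 :=
      Ideal.count_associates_eq hprime hpa (by rw [ha]; push_cast; ring)
    rw [hcount]
    constructor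
    · intro _
      exact ⟨a, ha⟩
    · intro _
      norm_num
  · have hcount : (Associates.mk (Ideal.span {((Rat.HeightOneSpectrum.natGenerator v : ℕ) : 𝓞 ℚ)})).count
        (Associates.mk (Ideal.span {(d : 𝓞 ℚ)})).factors = 0 :=
      Ideal.count_associates_eq (n := 0) hprime (a := (d : 𝓞 ℚ))
        (fun h ↦ hpd (rat_natCast_dvd_of_cast_dvd_cast h)) (by simp)
    rw [hcount]
    simp only [Nat.cast_zero, neg_zero, dvd_zero, not_true_eq_false, false_iff]
    exact hpd

/-- For squarefree `n`, the product of its prime factors (indexed by the subtype of primes) is `n`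
(`Nat.prod_primeFactors_of_squarefree`). [folklore] -/
private theorem prod_val_subtype_primeFactors {n : ℕ} (hn : Squarefree n) :
    ∏ q ∈ n.primeFactors.subtype Nat.Prime, (q : ℕ) = n := by
  rw [Finset.prod_subtype_eq_prod_filter (f := fun m : ℕ ↦ m),
    Finset.filter_true_of_mem (fun m hm ↦ (Nat.mem_primeFactors.1 hm).1),
    Nat.prod_primeFactors_of_squarefree hn]

/-- The height integrand at `v = (p)` for the class of a squarefree `d`: `p` if `p ∣ d`, else `1`.
[cite: BhargavaKlagsbrunLemkeOliverShnidman2019, §2 (Σ(X) for F = ℚ)] -/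
theorem squareClassHeight_integrand_squareClassOf_intCast (v : HeightOneSpectrum (𝓞 ℚ)) {d : ℤ}
    (hd : Squarefree d) :
    (if v.valuationOfNeZeroMod 2 (squareClassOf (d : ℚ)) = 1 then 1 else Ideal.absNorm v.asIdeal) =
      if ((Rat.HeightOneSpectrum.natGenerator v : ℕ) : ℤ) ∣ d then
        Rat.HeightOneSpectrum.natGenerator v else 1 := by
  by_cases h : ((Rat.HeightOneSpectrum.natGenerator v : ℕ) : ℤ) ∣ d
  · have hne := (valuationOfNeZeroMod_two_squareClassOf_ne_one_iff v hd).2 h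
    rw [if_neg hne, if_pos h, rat_absNorm_asIdeal_eq_natGenerator]
  · have heq : v.valuationOfNeZeroMod 2 (squareClassOf (d : ℚ)) = 1 := by
      by_contra hne
      exact h ((valuationOfNeZeroMod_two_squareClassOf_ne_one_iff v hd).1 hne)
    rw [if_pos heq, if_neg h]

/-- **`H([d]) = |d|` for a squarefree integer `d`** — Bhargava–Klagsbrun–Lemke Oliver–Shnidman
2019, §2: "If `F = ℚ`, then `Σ(X)` consists of the squareclasses of all squarefree integers of
absolute value less than `X`". The height `∏_{𝔭 : v_𝔭 odd} N𝔭` of `[d]` is the product of the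
primes dividing `d`, i.e. `|d|` (`Nat.prod_primeFactors_of_squarefree`).
[cite: BhargavaKlagsbrunLemkeOliverShnidman2019, §2 (Σ(X) for F = ℚ; chunk p0004 L30)] -/
theorem squareClassHeight_squareClassOf_intCast {d : ℤ} (hd : Squarefree d) :
    squareClassHeight (squareClassOf (d : ℚ)) = d.natAbs := by
  have hd0 : d.natAbs ≠ 0 := Int.natAbs_ne_zero.2 hd.ne_zero
  -- the integrand, read through `primesEquiv : primes of 𝓞_ℚ ≃ Nat.Primes`
  have hfun : (fun v : HeightOneSpectrum (𝓞 ℚ) ↦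
      if v.valuationOfNeZeroMod 2 (squareClassOf (d : ℚ)) = 1 then 1 else Ideal.absNorm v.asIdeal) =
      fun v ↦ (fun q : Nat.Primes ↦ if ((q : ℕ) : ℤ) ∣ d then (q : ℕ) else 1)
        (Rat.HeightOneSpectrum.primesEquiv v) := by
    funext v
    rw [squareClassHeight_integrand_squareClassOf_intCast v hd]
    rfl
  unfold squareClassHeight
  rw [hfun, finprod_comp_equiv Rat.HeightOneSpectrum.primesEquiv
    (f := fun q : Nat.Primes ↦ if ((q : ℕ) : ℤ) ∣ d then (q : ℕ) else 1)]
  -- `∏ᶠ` over `Nat.Primes` = `∏` over the prime factors of `|d|`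
  let S : Finset Nat.Primes := Finset.subtype Nat.Prime d.natAbs.primeFactors
  have hsupp : Function.mulSupport (fun q : Nat.Primes ↦ if ((q : ℕ) : ℤ) ∣ d then (q : ℕ) else 1) ⊆
      (S : Set Nat.Primes) := by
    intro q hq
    rw [Function.mem_mulSupport] at hq
    have hqd : ((q : ℕ) : ℤ) ∣ d := by
      by_contra h
      exact hq (if_neg h)
    rw [Finset.mem_coe]
    exact Finset.mem_subtype.2 (Nat.mem_primeFactors.2 ⟨q.2, Int.ofNat_dvd_left.1 hqd, hd0⟩)
  rw [finprod_eq_prod_of_mulSupport_subset _ hsupp]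
  have hprod : ∏ q ∈ S, (if ((q : ℕ) : ℤ) ∣ d then (q : ℕ) else 1) = ∏ q ∈ S, (q : ℕ) := by
    refine Finset.prod_congr rfl fun q hq ↦ ?_
    have hq' := Nat.mem_primeFactors.1 (Finset.mem_subtype.1 hq)
    exact if_pos (Int.ofNat_dvd_left.2 hq'.2.1)
  rw [hprod]
  exact prod_val_subtype_primeFactors (Int.squarefree_natAbs.2 hd)

/-! ### Counting: square classes of height `< X` = squarefree integers with `|d| < X` -/

/-- **`#{t ∈ ℚ^×/(ℚ^×)² : H(t) < X, P t} = #{d ∈ ℤ squarefree : |d| < X, P [d]}`** (BKLOS 2019,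
§2: over `ℚ`, `Σ(X)` "consists of the squareclasses of all squarefree integers of absolute value
less than `X`"): the bijection `d ↦ [d]` (`exists_squarefree_squareClassOf_eq`,
`eq_of_squareClassOf_intCast_eq`) has `H([d]) = |d|` (`squareClassHeight_squareClassOf_intCast`).
[cite: BhargavaKlagsbrunLemkeOliverShnidman2019, §2 (Σ(X) for F = ℚ; chunk p0004 L30)] -/
theorem natCard_squareClass_height_lt_eq (P : SquareClass ℚ → Prop) (X : ℕ) :
    Nat.card {t : SquareClass ℚ | squareClassHeight t < X ∧ P t} =
      Nat.card {d : ℤ | Squarefree d ∧ d.natAbs < X ∧ P (squareClassOf (d : ℚ))} := by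
  let F : {d : ℤ | Squarefree d ∧ d.natAbs < X ∧ P (squareClassOf (d : ℚ))} →
      {t : SquareClass ℚ | squareClassHeight t < X ∧ P t} :=
    fun d ↦ ⟨squareClassOf ((d : ℤ) : ℚ), by
      refine ⟨?_, d.2.2.2⟩
      rw [squareClassHeight_squareClassOf_intCast d.2.1]
      exact d.2.2.1⟩
  have hF : Function.Bijective F := by
    constructor
    · intro d₁ d₂ h
      have h' : squareClassOf ((d₁ : ℤ) : ℚ) = squareClassOf ((d₂ : ℤ) : ℚ) :=
        congrArg Subtype.val h
      exact Subtype.ext (eq_of_squareClassOf_intCast_eq d₁.2.1 d₂.2.1 h')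
    · intro t
      obtain ⟨d, hd, hdt⟩ := exists_squarefree_squareClassOf_eq (t : SquareClass ℚ)
      refine ⟨⟨d, hd, ?_, ?_⟩, Subtype.ext hdt⟩
      · rw [← squareClassHeight_squareClassOf_intCast hd, hdt]
        exact t.2.1
      · rw [hdt]
        exact t.2.2
  exact (Nat.card_congr (Equiv.ofBijective F hF)).symm

/-- The same without a condition: `#{t : H(t) < X} = #{d squarefree : |d| < X}`.
[cite: BhargavaKlagsbrunLemkeOliverShnidman2019, §2 (Σ(X) for F = ℚ; chunk p0004 L30)] -/
theorem natCard_squareClass_height_lt_eq' (X : ℕ) :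
    Nat.card {t : SquareClass ℚ | squareClassHeight t < X} =
      Nat.card {d : ℤ | Squarefree d ∧ d.natAbs < X} := by
  have h := natCard_squareClass_height_lt_eq (fun _ ↦ True) X
  simpa only [and_true] using h

/-! ### The two density currencies over `ℚ` agree -/

/-- **Over `ℚ`, "for at least `δ` of `t ∈ ℚ^×/(ℚ^×)²` (ordered by `H`), `P t`" is the statement
`δ ≤ liminf_X #{d squarefree : |d| < X, P [d]} / #{d squarefree : |d| < X}`** — the BKLOS height
ordering over `ℚ` is "the usual ordering of quadratic twists over `ℚ`" (BKLOS 2019, §2).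
[cite: BhargavaKlagsbrunLemkeOliverShnidman2019, §2 (Σ(X) for F = ℚ; chunk p0004 L30)] -/
theorem squareClassProportionGe_rat_iff (P : SquareClass ℚ → Prop) (δ : ℝ) :
    SquareClassProportionGe P δ ↔
      δ ≤ liminf (fun X : ℕ ↦
        (Nat.card {d : ℤ | Squarefree d ∧ d.natAbs < X ∧ P (squareClassOf (d : ℚ))} : ℝ) /
          Nat.card {d : ℤ | Squarefree d ∧ d.natAbs < X}) atTop := by
  unfold SquareClassProportionGe
  simp_rw [natCard_squareClass_height_lt_eq, natCard_squareClass_height_lt_eq']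

/-- The counting set `{d squarefree : |d| < X + 1 ∧ Q d}` is `{d squarefree : |d| ≤ X ∧ Q d}` (the
`|d| ≤ X` normalisation of the tree's `twistDensity`). [folklore] -/
private theorem setOf_squarefree_natAbs_lt_succ (X : ℕ) (Q : ℤ → Prop) :
    {d : ℤ | Squarefree d ∧ d.natAbs < X + 1 ∧ Q d} = {d : ℤ | Squarefree d ∧ |d| ≤ (X : ℤ) ∧ Q d} := by
  ext d
  simp only [Set.mem_setOf_eq, Nat.lt_succ_iff, Int.abs_eq_natAbs, Nat.cast_le]

/-- **If `{d squarefree : P [d]}` has natural density `δ₀` in the tree's `twistDensity` sense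
(squarefree `d` ordered by `|d| ≤ X`, a limit), then "for at least `δ` of `t ∈ ℚ^×/(ℚ^×)²`, `P t`"
(BKLOS height ordering, a `liminf`) holds iff `δ ≤ δ₀`.** So the two density currencies of the tree
agree over `ℚ` whenever the density exists. [cite: BhargavaKlagsbrunLemkeOliverShnidman2019, §2 (Σ(X) for F = ℚ; chunk p0004 L30)] -/
theorem squareClassProportionGe_iff_of_twistDensity {P : SquareClass ℚ → Prop} {P' : ℤ → Prop}
    {δ₀ : ℝ} (hP : ∀ d : ℤ, Squarefree d → (P' d ↔ P (squareClassOf (d : ℚ))))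
    (hdens : twistDensity P' δ₀) (δ : ℝ) :
    SquareClassProportionGe P δ ↔ δ ≤ δ₀ := by
  rw [squareClassProportionGe_rat_iff]
  set u : ℕ → ℝ := fun X ↦
    (Nat.card {d : ℤ | Squarefree d ∧ d.natAbs < X ∧ P (squareClassOf (d : ℚ))} : ℝ) /
      Nat.card {d : ℤ | Squarefree d ∧ d.natAbs < X} with hu
  have hshift : (fun X : ℕ ↦ u (X + 1)) = fun X : ℕ ↦
      (Nat.card {d : ℤ | Squarefree d ∧ |d| ≤ (X : ℤ) ∧ P' d} : ℝ) /
        Nat.card {d : ℤ | Squarefree d ∧ |d| ≤ (X : ℤ)} := by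
    funext X
    have hA : {d : ℤ | Squarefree d ∧ d.natAbs < X + 1 ∧ P (squareClassOf (d : ℚ))} =
        {d : ℤ | Squarefree d ∧ |d| ≤ (X : ℤ) ∧ P' d} := by
      rw [setOf_squarefree_natAbs_lt_succ X (fun d ↦ P (squareClassOf (d : ℚ)))]
      ext d
      simp only [Set.mem_setOf_eq]
      exact ⟨fun h ↦ ⟨h.1, h.2.1, (hP d h.1).2 h.2.2⟩, fun h ↦ ⟨h.1, h.2.1, (hP d h.1).1 h.2.2⟩⟩
    have hB : {d : ℤ | Squarefree d ∧ d.natAbs < X + 1} = {d : ℤ | Squarefree d ∧ |d| ≤ (X : ℤ)} := by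
      have h := setOf_squarefree_natAbs_lt_succ X (fun _ ↦ True)
      simpa only [and_true] using h
    simp only [hu]
    rw [hA, hB]
  have hlim : Tendsto (fun X : ℕ ↦ u (X + 1)) atTop (𝓝 δ₀) := by
    rw [hshift]
    exact hdens
  have hliminf : liminf u atTop = δ₀ := by
    rw [← Filter.liminf_nat_add u 1]
    exact hlim.liminf_eq
  rw [hliminf]

end Rat

/-! ### Twist classes at the class of an element; the twist-family form of the dictionary -/

section TwistGlue

variable {K : Type u} [Field K]

/-- **"`P` holds for the twist `E^{([s])}`" is `P (E^{(s)})`** for an isomorphism-invariant property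
`P` and `s ≠ 0` (`TwistClassSatisfies` quantifies over all representatives of the class; for
invariant `P` one representative decides, `twistClassSatisfies_iff_exists`). BKLOS 2019, §2 ("For
any squareclass `s ∈ F^*/F^{*2}`, the quadratic twist `A_s`"); Burungale–Tian 2026, Prop. 1.3
(`E^{(t)}`). [cite: BhargavaKlagsbrunLemkeOliverShnidman2019, §2 (the twists A_s of a squareclass s)] -/
theorem twistClassSatisfies_squareClassOf_iff (V : WeierstrassCurve K) (P : WeierstrassCurve K → Prop)
    (hP : ∀ s s' : Kˣ, (QuotientGroup.mk s : SquareClass K) = QuotientGroup.mk s' →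
      (P (V.quadraticTwist (s : K)) ↔ P (V.quadraticTwist (s' : K))))
    {s : K} (hs : s ≠ 0) :
    TwistClassSatisfies V P (squareClassOf s) ↔ P (V.quadraticTwist s) := by
  rw [squareClassOf_of_ne_zero hs, twistClassSatisfies_iff_exists V P hP]
  constructor
  · rintro ⟨s', hs', h⟩
    exact (hP _ _ hs').1 h
  · intro h
    exact ⟨Units.mk0 s hs, rfl, h⟩

variable [NumberField K]

/-- The `Sel_{p^∞}`-corank-`0` predicate of Burungale–Tian Thm. 3.5 at the class `[s]`, `s ≠ 0`:
`corank Sel_{p^∞}(E^{(s)}/K) = 0`. [cite: BurungaleTian2026, Thm. 3.5 (§3.2.2, p. 7)] -/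
theorem twistClassSatisfies_selmerCorank_squareClassOf_iff (V : WeierstrassCurve K) (p : ℕ) {s : K}
    (hs : s ≠ 0) :
    TwistClassSatisfies V (fun E : WeierstrassCurve K ↦ E.selmerCorank p = 0) (squareClassOf s) ↔
      (V.quadraticTwist s).selmerCorank p = 0 :=
  twistClassSatisfies_squareClassOf_iff V _
    (fun _ _ h ↦ by rw [selmerCorank_quadraticTwist_eq_of_mk_eq V p h]) hs

/-- The analytic-rank-`0` predicate of Burungale–Tian Prop. 1.3 at the class `[s]`, `s ≠ 0`:
`ord_{s=1} L(E^{(s)}/K, s) = 0` (`V` elliptic). [cite: BurungaleTian2026, Prop. 1.3 (p. 2)] -/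
theorem twistClassSatisfies_analyticRank_squareClassOf_iff (V : WeierstrassCurve K) [V.IsElliptic]
    {s : K} (hs : s ≠ 0) :
    TwistClassSatisfies V (fun E : WeierstrassCurve K ↦ E.analyticRank = 0) (squareClassOf s) ↔
      (V.quadraticTwist s).analyticRank = 0 :=
  twistClassSatisfies_squareClassOf_iff V _
    (fun _ _ h ↦ by rw [analyticRank_quadraticTwist_eq_of_mk_eq V h]) hs

end TwistGlue

section RatTwist

/-- **The twist-family dictionary over `ℚ`**: for `E/ℚ` and an isomorphism-invariant property `P`,
"for at least `δ` of `t ∈ ℚ^×/(ℚ^×)²` (by height), `P(E^{(t)})`" (BKLOS) is the statement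
`δ ≤ liminf_X #{d squarefree : |d| < X, P(E^{(d)})} / #{d squarefree : |d| < X}` (the usual
ordering of quadratic twists over `ℚ`, BKLOS 2019 §2).
[cite: BhargavaKlagsbrunLemkeOliverShnidman2019, §2 (Σ(X) for F = ℚ; chunk p0004 L30)] -/
theorem squareClassProportionGe_twist_rat_iff (V : WeierstrassCurve ℚ) (P : WeierstrassCurve ℚ → Prop)
    (hP : ∀ s s' : ℚˣ, (QuotientGroup.mk s : SquareClass ℚ) = QuotientGroup.mk s' →
      (P (V.quadraticTwist (s : ℚ)) ↔ P (V.quadraticTwist (s' : ℚ)))) (δ : ℝ) :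
    SquareClassProportionGe (TwistClassSatisfies V P) δ ↔
      δ ≤ liminf (fun X : ℕ ↦
        (Nat.card {d : ℤ | Squarefree d ∧ d.natAbs < X ∧ P (V.quadraticTwist (d : ℚ))} : ℝ) /
          Nat.card {d : ℤ | Squarefree d ∧ d.natAbs < X}) atTop := by
  rw [squareClassProportionGe_rat_iff]
  have hset : ∀ X : ℕ,
      {d : ℤ | Squarefree d ∧ d.natAbs < X ∧ TwistClassSatisfies V P (squareClassOf (d : ℚ))} =
        {d : ℤ | Squarefree d ∧ d.natAbs < X ∧ P (V.quadraticTwist (d : ℚ))} := by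
    intro X
    ext d
    simp only [Set.mem_setOf_eq]
    constructor
    · rintro ⟨hsf, hlt, h⟩
      exact ⟨hsf, hlt, (twistClassSatisfies_squareClassOf_iff V P hP
        (cast_ne_zero_of_squarefree hsf)).1 h⟩
    · rintro ⟨hsf, hlt, h⟩
      exact ⟨hsf, hlt, (twistClassSatisfies_squareClassOf_iff V P hP
        (cast_ne_zero_of_squarefree hsf)).2 h⟩
  simp_rw [hset]

/-- **… and, when the natural density exists, it decides the BKLOS proportion**: if
`{d squarefree : P(E^{(d)})}` has density `δ₀` (tree `twistDensity`, `|d| ≤ X`), then "for at least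
`δ` of `t ∈ ℚ^×/(ℚ^×)²`, `P(E^{(t)})`" holds iff `δ ≤ δ₀`.
[cite: BhargavaKlagsbrunLemkeOliverShnidman2019, §2 (Σ(X) for F = ℚ; chunk p0004 L30)] -/
theorem squareClassProportionGe_twist_iff_of_twistDensity (V : WeierstrassCurve ℚ)
    (P : WeierstrassCurve ℚ → Prop)
    (hP : ∀ s s' : ℚˣ, (QuotientGroup.mk s : SquareClass ℚ) = QuotientGroup.mk s' →
      (P (V.quadraticTwist (s : ℚ)) ↔ P (V.quadraticTwist (s' : ℚ)))) {δ₀ : ℝ}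
    (hdens : twistDensity (fun d : ℤ ↦ P (V.quadraticTwist (d : ℚ))) δ₀) (δ : ℝ) :
    SquareClassProportionGe (TwistClassSatisfies V P) δ ↔ δ ≤ δ₀ :=
  squareClassProportionGe_iff_of_twistDensity
    (fun _ hd ↦ (twistClassSatisfies_squareClassOf_iff V P hP (cast_ne_zero_of_squarefree hd)).symm)
    hdens δ

/-- The `Sel_{p^∞}`-corank-`0` instance of the twist-family dictionary over `ℚ`: "at least `δ` of
the twist classes have `corank Sel_{p^∞} = 0`" iff
`δ ≤ liminf_X #{d squarefree : |d| < X, corank Sel_{p^∞}(E^{(d)}/ℚ) = 0} / #{d squarefree : |d| < X}`.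
[cite: BhargavaKlagsbrunLemkeOliverShnidman2019, §2 (Σ(X) for F = ℚ; chunk p0004 L30)] -/
theorem squareClassProportionGe_twist_selmerCorank_rat_iff (V : WeierstrassCurve ℚ) (p : ℕ) (δ : ℝ) :
    SquareClassProportionGe
        (TwistClassSatisfies V fun E : WeierstrassCurve ℚ ↦ E.selmerCorank p = 0) δ ↔
      δ ≤ liminf (fun X : ℕ ↦
        (Nat.card {d : ℤ | Squarefree d ∧ d.natAbs < X ∧
            (V.quadraticTwist (d : ℚ)).selmerCorank p = 0} : ℝ) /
          Nat.card {d : ℤ | Squarefree d ∧ d.natAbs < X}) atTop :=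
  squareClassProportionGe_twist_rat_iff V _
    (fun _ _ h ↦ by rw [selmerCorank_quadraticTwist_eq_of_mk_eq V p h]) δ

/-- The analytic-rank-`0` instance of the twist-family dictionary over `ℚ` (`E` elliptic).
[cite: BhargavaKlagsbrunLemkeOliverShnidman2019, §2 (Σ(X) for F = ℚ; chunk p0004 L30)] -/
theorem squareClassProportionGe_twist_analyticRank_rat_iff (V : WeierstrassCurve ℚ) [V.IsElliptic]
    (δ : ℝ) :
    SquareClassProportionGe
        (TwistClassSatisfies V fun E : WeierstrassCurve ℚ ↦ E.analyticRank = 0) δ ↔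
      δ ≤ liminf (fun X : ℕ ↦
        (Nat.card {d : ℤ | Squarefree d ∧ d.natAbs < X ∧
            (V.quadraticTwist (d : ℚ)).analyticRank = 0} : ℝ) /
          Nat.card {d : ℤ | Squarefree d ∧ d.natAbs < X}) atTop :=
  squareClassProportionGe_twist_rat_iff V _
    (fun _ _ h ↦ by rw [analyticRank_quadraticTwist_eq_of_mk_eq V h]) δ

end RatTwist

end Literature.NumberTheory.EllipticCurves

end
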